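import Summits.QuantumFields.BalabanUV.Beta.FP.StepLawLeft

/-!
# `BalabanUV.Beta.FP.StepLawLeftDefect` — road «FP» for binder row D1, PROPOSED RULING R-FP-47 door (ii) «GHOST-RG», END v2′ LINK 5 (A):
# THE STEP LAW OF THE PERFECT COEFFICIENT FAMILY WITH THE FIXED-POINT DEFECT DISPLAYED, NOT ASSUMED ZERO —
# `fPerfG (m+1) = fPerfG m + fPerfG 1 + secondMoment (defect TP RP m) μ ν` (abstract socket, generic four-slot family, LEFT literal family)

HONEST DEPENDENCY (page 1, mandatory): continuum YM on T⁴ ⇐ BetaPertH ∧ nine spine estimates (0/9 proved); BetaPertH ⇐ (D1) ∧ (D4) ∧ CAP+tail;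
G-an2-4 gates asym, D1 and NE2/3/4.  HONEST FRAMING (cell contract, verbatim): «discharging `BetaPertH` makes Bałaban's UV stability UNCONDITIONAL —
a real constructive-QFT result; it is NOT the continuum limit and NOT the Clay problem.»  THIS MODULE is [folklore] Fubini bookkeeping + [our object]
COMPOSITION BY NAME: the gen-4 socket `StepLawWard.secondMoment_succ_of_fubini_ward`, the gen-3 generic step law
`StepLawWardGeneric.fPerfG_succ_of_ward_symm_explicitDefect` and the gen-10 LEFT step laws `StepLawLeft.stepLaw_left_of_(rows_)ward_symm_explicitDefect`, EACH
WITH ITS `hSDF` BINDER STRUCK and the `(μ,ν)` second moment of the explicit defect CARRIED on the right-hand side instead.  No `def`, no `def … : Prop`,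
nothing cited, 0 sorry; 0∕4 row-D1 binders; every analytic statement stays a HYPOTHESIS; NOT (CONV-C), NOT SDF, NOT D1, NOT BetaPertH, NOT continuum,
NOT Clay.  «not in print; our bookkeeping».

ABSOLUTE RULE (cell charter, verbatim): «No internally-minted statement may enter as a cited fact. Every hypothesis is either kernel-proved in this package or a
verbatim quotation of a PUBLISHED theorem with page reference. The manuscript(s) under audit are NOT citable for their own disputed steps — they are the thing
under adjudication; programme-internal (2001/route/tribunal) claims are never citable.»

WHY (E-FP-15-2 ∕ PROPOSED R-FP-47, journal l.34659 ∕ l.34829).  Door (ii) «GHOST-RG» replaces the exact (STEP)∕(SDF) binder of road FP by «the perfect step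
defects have BOUNDED PARTIAL SUMS»: the OWNER's `RoadEndPowdev.d1Drift_of_self_summableDefect_bounded` reads a VARIABLE-DEFECT step law
`fPerfG (m+1) = fPerfG m + fPerfG 1 + δ m` with `|Σ_{k ∈ Ico 1 m} δ k| ≤ D`.  This file SUPPLIES that step law with
`δ m := secondMoment (defect TP RP m) μ ν` — the `(μ,ν)` second moment of the EXPLICIT fixed-point defect `TP (m+1) − RP m − TP m` against the UNDRESSED perfect
column `colOf (KPerf m)` — from EXACTLY the data the exact step law used MINUS `hSDF`: class data of the perfect objects, the Ward row `hWf` of the flipped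
perfect one-step kernel, its transposition symmetry `hTsymm`.  So the (SDF) letter of the LEFT literal chain becomes an ESTIMATE-shaped binder
(`RoadLeftAssemblySDFPowdev` ∕ `RoadLeftAssemblyRowsPowdev`, LINK 5 (B)∕(C); the OWNER's LINK 4 `RoadLeftAssemblyPowdev` does `hstep ↦ hdev` at the STEP letter).

CONTENT.
* §1 [folklore] **`secondMoment_succ_of_fubini_ward_defect`** (abstract `EKer 4`): `StepLawWard.secondMoment_succ_of_fubini_ward` WITHOUT `hSDF`; conclusion
  `secondMoment (TP (m+1)) μ ν = secondMoment (TP m) μ ν + secondMoment (TP 1) μ ν + secondMoment (D m) μ ν`.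
* §2 [our object] **`fPerfG_succ_of_ward_symm_defect`** (generic four-slot family, `d = 3`, `2 ≤ Lc`): `StepLawWardGeneric.fPerfG_succ_of_ward_symm_explicitDefect`
  WITHOUT `hSDF`; conclusion `fPerfG (m+1) = fPerfG m + fPerfG 1 + secondMoment (defect … m) μ ν`.
* §3 [our object] **`stepLaw_left_of_ward_symm_defect`**, **`stepLaw_left_of_rows_ward_symm_defect`** (the LEFT literal family, adopted units): the twins of
  `StepLawLeft`'s two theorems WITHOUT `hSDF` — VERBATIM the `hstep` binder of `RoadEndPowdev.d1Drift_of_self_summableDefect_bounded` at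
  `G := (j, m) ↦ KTot (Lc^(j+m)) (Lc^j)` with `δ m :=` the defect's `(μ,ν)` second moment.
Provenance: unit `b2b-balaban-beta-d1-formalise-leaf-02` gen 15 (prover-b2b-balaban-beta-d1-formalise-leaf-02-g15-0), 2026-08-21; END v2′ LINK 5 (first refusal
leaf-06 ∕ leaf-02, OWNER d1-p3 g15 l.34829 ∕ l.35046); new file, nothing appended to others' modules.
-/

noncomputable section

namespace Summit.QuantumFields.BalabanUV.Beta.FP.StepLawLeftDefect

open Finset Filter Topology
open scoped BigOperators
open Literature.MathematicalPhysics.QuantumFieldTheory.Balaban1983to89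
open Literature.MathematicalPhysics.QuantumFieldTheory.Balaban1983to89.Beta
open B12Beta (secondMoment)
open DecimatedMomentSummable (IsMoment₂ ConstReproSum LinReproSum AbsMoment₂ summable_smul_of_absMoment₂)
open DressedMomentNormalisation (EKer m2Tensor dressedEntry)
open ExpKernelCalculus (MKer Decays VertexFamily₂ hessKer)
open PolarizationSign (WardTransversal)
open OneStepResolventKernel (Fib LocStencil)
open OneStepKernelFamily (vertexOfK flipK)
open HessKerDressedLimit (vertexFamily₂_limTabOf)
open Summit.QuantumFields.BalabanUV.Beta.HessKerDressedUnits (unitS unitW)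
open Summit.QuantumFields.BalabanUV.Beta.GAN24.CombesThomas (sfStep smStep)
open Summit.QuantumFields.BalabanUV.Beta.FP.PerfectObjects (KTot)
open Summit.QuantumFields.BalabanUV.Beta.FP.PerfectObjectsT (KPerf SPerfOf WPerfOf)
open Summit.QuantumFields.BalabanUV.Beta.FP.TransportInfinityM (colOf)
open Summit.QuantumFields.BalabanUV.Beta.FP.StepDefectInherit (defect fubini_defect)
open Summit.QuantumFields.BalabanUV.Beta.FP.StepLawAssembly (secondMoment_eq_m2Tensor)
open Summit.QuantumFields.BalabanUV.Beta.FP.StepLawWard (hasSum_transport_entry_of_ward wardDiag_of_ward_flip)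
open Summit.QuantumFields.BalabanUV.Beta.FP.StepLawInherit (absMoment₂_defect_explicit)
open Summit.QuantumFields.BalabanUV.Beta.FP.StepLawWardGeneric (absMoment₂_TGenOf)
open Summit.QuantumFields.BalabanUV.Beta.FP.PerfectBubbleSandwich (entryHyps_perfCol_zero)
open Summit.QuantumFields.BalabanUV.Beta.FP.PerfectColumnKronecker (linReproSum_perfCol_offDiag_holds)
open Summit.QuantumFields.BalabanUV.Beta.FP.RoadEndGeneric (KPerfOf TGenOf fPerfG fPerfG_def)
open Summit.QuantumFields.BalabanUV.Beta.FP.StepLawKHolds (exists_decays_KPerf_holds)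
open Summit.QuantumFields.BalabanUV.Beta.FP.PerfectJetLetters (locStencil_sPerf_of_rows)

/-! ## §1 The abstract socket with the defect displayed -/

section Abstract

variable {TP w D : ℕ → EKer 4} {N : ℕ → ℕ}

/-- [folklore] **ONE MORE PERFECT STEP AT THE (1.22) READ-OUT, DEFECT DISPLAYED.**  `StepLawWard.secondMoment_succ_of_fubini_ward` with its binder
`hSDF : secondMoment (D m) μ ν = 0` STRUCK: Kronecker masses + SOME (L1∞) constants with the off-diagonal ones ZERO + AbsMoment₂ of the columns, and for
the one-step kernel `TP 1`: AbsMoment₂, transposition symmetry, (T0), DIAGONAL (T1); AbsMoment₂ of every `TP m` and of every defect `D m`.  Conclusion: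
`∀ m ≥ 1, secondMoment (TP (m+1)) μ ν = secondMoment (TP m) μ ν + secondMoment (TP 1) μ ν + secondMoment (D m) μ ν`. -/
theorem secondMoment_succ_of_fubini_ward_defect
    (hfub : ∀ m : ℕ, 1 ≤ m → ∀ (a b : Fin 4) (z : Fin 4 → ℤ),
      TP (m + 1) a b z = ((N m : ℕ) : ℝ) ^ 8 * dressedEntry (w m) (TP 1) (((N m : ℕ) : ℤ) • z) a b + TP m a b z + D m a b z)
    (hN : ∀ m : ℕ, 1 ≤ m → 0 < N m)
    (hw0 : ∀ m : ℕ, 1 ≤ m → ∀ κ l, ConstReproSum (N m) (w m κ l) (if κ = l then ((((N m : ℕ) : ℝ) ^ (4 + 1))⁻¹) else 0))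
    (hw1 : ∀ m : ℕ, 1 ≤ m → ∀ κ l, ∃ C : Fin 4 → ℝ, LinReproSum (N m) (w m κ l) C)
    (hw1off : ∀ m : ℕ, 1 ≤ m → ∀ κ l, κ ≠ l → LinReproSum (N m) (w m κ l) 0) (hwA : ∀ m : ℕ, 1 ≤ m → ∀ κ l, AbsMoment₂ (w m κ l))
    (hTA : ∀ c e, AbsMoment₂ (TP 1 c e)) (hTsymm : ∀ c e t, TP 1 c e t = TP 1 e c (-t)) (hT0 : ∀ c e, HasSum (TP 1 c e) 0)
    (hT1d : ∀ c e, HasSum (fun t : Fin 4 → ℤ => (t c : ℝ) * TP 1 c e t) 0)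
    (hA : ∀ m : ℕ, 1 ≤ m → ∀ a b : Fin 4, AbsMoment₂ (TP m a b)) (hDA : ∀ m : ℕ, 1 ≤ m → ∀ a b : Fin 4, AbsMoment₂ (D m a b))
    (μ ν : Fin 4) :
    ∀ m : ℕ, 1 ≤ m →
      secondMoment (TP (m + 1)) μ ν = secondMoment (TP m) μ ν + secondMoment (TP 1) μ ν + secondMoment (D m) μ ν := by
  intro m hm
  have h1 := hasSum_transport_entry_of_ward (hN m hm) (w m) (TP 1) (hw0 m hm) (hw1 m hm) (hw1off m hm) (hwA m hm) hTA hTsymm hT0 hT1d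
    (κ := μ) (lam := ν) (a := μ) (b := ν) (Or.inl rfl) (Or.inr rfl)
  have h2 : Summable (fun t : Fin 4 → ℤ => (t μ * t ν) • TP m μ ν t) := summable_smul_of_absMoment₂ (hA m hm μ ν) (IsMoment₂.coord2 μ ν)
  have h3 : Summable (fun t : Fin 4 → ℤ => (t μ * t ν) • D m μ ν t) := summable_smul_of_absMoment₂ (hDA m hm μ ν) (IsMoment₂.coord2 μ ν)
  have hten : m2Tensor (TP (m + 1)) μ ν μ ν = m2Tensor (TP 1) μ ν μ ν + m2Tensor (TP m) μ ν μ ν + m2Tensor (D m) μ ν μ ν := by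
    calc m2Tensor (TP (m + 1)) μ ν μ ν
        = ∑' t : Fin 4 → ℤ, (((t μ * t ν) • (((N m : ℕ) : ℝ) ^ 8 * dressedEntry (w m) (TP 1) (((N m : ℕ) : ℤ) • t) μ ν)
            + (t μ * t ν) • TP m μ ν t) + (t μ * t ν) • D m μ ν t) := by
          show (∑' t : Fin 4 → ℤ, (t μ * t ν) • TP (m + 1) μ ν t) = _
          exact tsum_congr fun t => by rw [hfub m hm μ ν t, smul_add, smul_add]
      _ = m2Tensor (TP 1) μ ν μ ν + m2Tensor (TP m) μ ν μ ν + m2Tensor (D m) μ ν μ ν := by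
          rw [Summable.tsum_add (h1.summable.add h2) h3, Summable.tsum_add h1.summable h2, h1.tsum_eq]
          rfl
  rw [secondMoment_eq_m2Tensor, secondMoment_eq_m2Tensor, secondMoment_eq_m2Tensor, secondMoment_eq_m2Tensor, hten]
  ring

end Abstract

/-! ## §2 The step law of the generic perfect coefficient family, defect displayed -/

section Step

variable {Lc : ℕ} [NeZero Lc] (sf sm : ℕ → ℝ) (A G : ℕ → ℕ → MKer (3 + 1) (Fib 3))
  (S : ℕ → ℕ → Fin (3 + 1) → (Fin (3 + 1) → ℤ) → MKer (3 + 1) (Fib 3))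
  (Wt : ℕ → ℕ → Fin (3 + 1) → (Fin (3 + 1) → ℤ) → Fin (3 + 1) → (Fin (3 + 1) → ℤ) → MKer (3 + 1) (Fib 3))

/-- **THE STEP LAW OF THE GENERIC PERFECT COEFFICIENT FAMILY, DEFECT DISPLAYED** [our object] (`d = 3`, `2 ≤ Lc`; any resolvent families `A`, `G`, any
stencils∕tables, any units): `StepLawWardGeneric.fPerfG_succ_of_ward_symm_explicitDefect` with `hSDF` STRUCK.  DISPLAYED: class data of the perfect objects at
every `m ≥ 1`, the Ward row `hWf` of the flipped perfect one-step kernel, its transposition symmetry `hTsymm`.  CONCLUSION: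
`∀ m ≥ 1, fPerfG … (m+1) = fPerfG … m + fPerfG … 1 + secondMoment (defect TP RP m) μ ν`, the defect taken against the UNDRESSED perfect column
`colOf (KPerf Lc (sfStep Lc) (smStep 3 Lc) m)` (its Kronecker rows are tree theorems, K-side UNCONDITIONAL). -/
theorem fPerfG_succ_of_ward_symm_defect (hLc : 2 ≤ Lc)
    (hAinf : ∀ m : ℕ, 1 ≤ m → ∃ δ C : ℝ, 0 < δ ∧ 0 ≤ C ∧ Decays (KPerfOf (d := 3) sf sm A m) C δ)
    (hGinf : ∀ m : ℕ, 1 ≤ m → ∃ δ C : ℝ, 0 < δ ∧ 0 ≤ C ∧ Decays (KPerfOf (d := 3) sf sm G m) C δ)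
    (hSinf : ∀ m : ℕ, 1 ≤ m → ∃ Cs δS : ℝ, 0 < δS ∧ LocStencil (SPerfOf sf sm S m) Cs δS)
    (hWinf : ∀ m : ℕ, 1 ≤ m → ∃ Cw δW : ℝ, 0 < δW ∧ VertexFamily₂ (WPerfOf sf sm Wt m) (Lc ^ m) Cw δW)
    (hWf : WardTransversal (flipK (TGenOf Lc (KPerfOf sf sm A 1) (KPerfOf sf sm G 1) (SPerfOf sf sm S 1) (WPerfOf sf sm Wt 1))))
    (hTsymm : ∀ a b t, TGenOf Lc (KPerfOf sf sm A 1) (KPerfOf sf sm G 1) (SPerfOf sf sm S 1) (WPerfOf sf sm Wt 1) a b t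
      = TGenOf Lc (KPerfOf sf sm A 1) (KPerfOf sf sm G 1) (SPerfOf sf sm S 1) (WPerfOf sf sm Wt 1) b a (-t))
    (μ ν : Fin 4) :
    ∀ m : ℕ, 1 ≤ m → fPerfG Lc sf sm A G S Wt μ ν (m + 1) = fPerfG Lc sf sm A G S Wt μ ν m + fPerfG Lc sf sm A G S Wt μ ν 1 +
      secondMoment (defect
        (fun m => TGenOf (Lc ^ m) (KPerfOf sf sm A m) (KPerfOf sf sm G m) (SPerfOf sf sm S m) (WPerfOf sf sm Wt m))
        (fun m a b z => ((Lc ^ m : ℕ) : ℝ) ^ 8 * dressedEntry (colOf (KPerf (d := 3) Lc (sfStep Lc) (smStep 3 Lc) m))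
          (TGenOf Lc (KPerfOf sf sm A 1) (KPerfOf sf sm G 1) (SPerfOf sf sm S 1) (WPerfOf sf sm Wt 1))
          (((Lc ^ m : ℕ) : ℤ) • z) a b) m) μ ν := by
  set TP : ℕ → EKer 4 := fun m => TGenOf (Lc ^ m) (KPerfOf sf sm A m) (KPerfOf sf sm G m) (SPerfOf sf sm S m) (WPerfOf sf sm Wt m)
    with hTP
  have hTP1 : TP 1 = TGenOf Lc (KPerfOf sf sm A 1) (KPerfOf sf sm G 1) (SPerfOf sf sm S 1) (WPerfOf sf sm Wt 1) := by
    simp only [hTP, pow_one]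
  -- `AbsMoment₂` of every member from the class data
  have hA : ∀ m : ℕ, 1 ≤ m → ∀ a b, AbsMoment₂ (TP m a b) := fun m hm a b => by
    obtain ⟨Csm, δSm, hδSm, hSm⟩ := hSinf m hm
    obtain ⟨Cwm, δWm, hδWm, hWm⟩ := hWinf m hm
    exact absMoment₂_TGenOf (Nat.one_le_pow _ _ (by omega)) (hAinf m hm) (hGinf m hm) hSm hδSm hWm hδWm a b
  have hT : ∀ a b, AbsMoment₂ (TP 1 a b) := hA 1 le_rfl
  have hWf' : WardTransversal (flipK (TP 1)) := by rw [hTP1]; exact hWf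
  obtain ⟨hT0, hT1d⟩ := wardDiag_of_ward_flip hT hWf'
  have hTsymm' : ∀ a b t, TP 1 a b t = TP 1 b a (-t) := by rw [hTP1]; exact hTsymm
  -- the explicit defect: `hfub` definitional, `hDA` from `AbsMoment₂`
  have hDA := absMoment₂_defect_explicit (TP := TP) (w := fun m => colOf (KPerf (d := 3) Lc (sfStep Lc) (smStep 3 Lc) m))
    (N := fun m => Lc ^ m) (fun m _ => pow_ne_zero _ (NeZero.ne Lc)) (fun m hm => (entryHyps_perfCol_zero hLc hm).absW) hA
  have hfub : ∀ m : ℕ, 1 ≤ m → ∀ (a b : Fin 4) (z : Fin 4 → ℤ),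
      TP (m + 1) a b z = ((Lc ^ m : ℕ) : ℝ) ^ 8 * dressedEntry (colOf (KPerf (d := 3) Lc (sfStep Lc) (smStep 3 Lc) m)) (TP 1)
        (((Lc ^ m : ℕ) : ℤ) • z) a b + TP m a b z
        + defect TP (fun m a b z => ((Lc ^ m : ℕ) : ℝ) ^ 8 * dressedEntry (colOf (KPerf (d := 3) Lc (sfStep Lc) (smStep 3 Lc) m)) (TP 1)
            (((Lc ^ m : ℕ) : ℤ) • z) a b) m a b z :=
    fun m _ a b z => fubini_defect (TP := TP)
      (RP := fun m a b z => ((Lc ^ m : ℕ) : ℝ) ^ 8 * dressedEntry (colOf (KPerf (d := 3) Lc (sfStep Lc) (smStep 3 Lc) m)) (TP 1)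
        (((Lc ^ m : ℕ) : ℤ) • z) a b) m a b z
  have h := secondMoment_succ_of_fubini_ward_defect (TP := TP) (w := fun m => colOf (KPerf (d := 3) Lc (sfStep Lc) (smStep 3 Lc) m))
    (N := fun m => Lc ^ m) hfub (fun m _ => Nat.pos_of_ne_zero (pow_ne_zero _ (NeZero.ne Lc)))
    (fun m hm => (entryHyps_perfCol_zero hLc hm).const) (fun m hm => (entryHyps_perfCol_zero hLc hm).lin)
    (fun m hm κ l hκl => linReproSum_perfCol_offDiag_holds hLc hm hκl) (fun m hm => (entryHyps_perfCol_zero hLc hm).absW)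
    hT hTsymm' hT0 hT1d hA hDA μ ν
  intro m hm
  have h' := h m hm
  rw [hTP1] at h'
  simpa only [fPerfG_def, TGenOf, hTP, pow_one] using h'

end Step

/-! ## §3 The step law of the LEFT perfect family, defect displayed -/

section Left

variable {Lc : ℕ} [NeZero Lc]
  (S : ℕ → ℕ → Fin (3 + 1) → (Fin (3 + 1) → ℤ) → MKer (3 + 1) (Fib 3))
  (Wt : ℕ → ℕ → Fin (3 + 1) → (Fin (3 + 1) → ℤ) → Fin (3 + 1) → (Fin (3 + 1) → ℤ) → MKer (3 + 1) (Fib 3))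

/-- **THE STEP LAW OF THE LEFT PERFECT FAMILY, K-SIDE UNCONDITIONAL, DEFECT DISPLAYED** [our object] (`d = 3`, `2 ≤ Lc`, adopted units
`(sfStep Lc, smStep 3 Lc)`).  Write `T^s_m := hessKer (KPerf m) (vertexOfK (KPerf m) (Lc^m) (SPerfOf S m)) (WPerfOf Wt m)` and `D_m := T^s_{m+1} −
(Lc^m)⁸·dressedEntry (colOf (KPerf m)) T^s_1 ((Lc^m)•·) − T^s_m` (the EXPLICIT fixed-point defect).  DISPLAYED: class data of the perfect stencils and tables
for every `m ≥ 1`; the Ward row `hWf : WardTransversal (flipK T^s_1)`; the transposition symmetry `hTsymm`.  NOT displayed: the class data of `KPerf m`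
(`StepLawKHolds.exists_decays_KPerf_holds`), the column's Kronecker rows.  CONCLUSION — VERBATIM the `hstep` binder of
`RoadEndPowdev.d1Drift_of_self_summableDefect_bounded` at `G := (j, m) ↦ KTot (Lc^(j+m)) (Lc^j)`, adopted units, with `δ m := secondMoment D_m μ ν`:
`∀ m ≥ 1, fPerfG … (m+1) = fPerfG … m + fPerfG … 1 + secondMoment D_m μ ν`.  `StepLawLeft.stepLaw_left_of_ward_symm_explicitDefect` with `hSDF` STRUCK. -/
theorem stepLaw_left_of_ward_symm_defect (hLc : 2 ≤ Lc)
    (hSinf : ∀ m : ℕ, 1 ≤ m → ∃ Cs δS : ℝ, 0 < δS ∧ LocStencil (SPerfOf (sfStep Lc) (smStep 3 Lc) S m) Cs δS)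
    (hWinf : ∀ m : ℕ, 1 ≤ m → ∃ Cw δW : ℝ, 0 < δW ∧ VertexFamily₂ (WPerfOf (sfStep Lc) (smStep 3 Lc) Wt m) (Lc ^ m) Cw δW)
    (hWf : WardTransversal (flipK (hessKer (KPerf (d := 3) Lc (sfStep Lc) (smStep 3 Lc) 1)
      (vertexOfK (KPerf (d := 3) Lc (sfStep Lc) (smStep 3 Lc) 1) Lc (SPerfOf (sfStep Lc) (smStep 3 Lc) S 1)) (WPerfOf (sfStep Lc) (smStep 3 Lc) Wt 1))))
    (hTsymm : ∀ a b t, hessKer (KPerf (d := 3) Lc (sfStep Lc) (smStep 3 Lc) 1)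
        (vertexOfK (KPerf (d := 3) Lc (sfStep Lc) (smStep 3 Lc) 1) Lc (SPerfOf (sfStep Lc) (smStep 3 Lc) S 1)) (WPerfOf (sfStep Lc) (smStep 3 Lc) Wt 1) a b t =
      hessKer (KPerf (d := 3) Lc (sfStep Lc) (smStep 3 Lc) 1)
        (vertexOfK (KPerf (d := 3) Lc (sfStep Lc) (smStep 3 Lc) 1) Lc (SPerfOf (sfStep Lc) (smStep 3 Lc) S 1)) (WPerfOf (sfStep Lc) (smStep 3 Lc) Wt 1) b a (-t))
    (μ ν : Fin 4) :
    ∀ m : ℕ, 1 ≤ m →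
      fPerfG Lc (sfStep Lc) (smStep 3 Lc) (fun j m => KTot (d := 3) (Lc ^ (j + m)) (Lc ^ j)) (fun j m => KTot (d := 3) (Lc ^ (j + m)) (Lc ^ j))
          S Wt μ ν (m + 1) =
        fPerfG Lc (sfStep Lc) (smStep 3 Lc) (fun j m => KTot (d := 3) (Lc ^ (j + m)) (Lc ^ j)) (fun j m => KTot (d := 3) (Lc ^ (j + m)) (Lc ^ j))
            S Wt μ ν m +
          fPerfG Lc (sfStep Lc) (smStep 3 Lc) (fun j m => KTot (d := 3) (Lc ^ (j + m)) (Lc ^ j)) (fun j m => KTot (d := 3) (Lc ^ (j + m)) (Lc ^ j))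
            S Wt μ ν 1 +
          secondMoment (defect
            (fun m => hessKer (KPerf (d := 3) Lc (sfStep Lc) (smStep 3 Lc) m)
              (vertexOfK (KPerf (d := 3) Lc (sfStep Lc) (smStep 3 Lc) m) (Lc ^ m) (SPerfOf (sfStep Lc) (smStep 3 Lc) S m)) (WPerfOf (sfStep Lc) (smStep 3 Lc) Wt m))
            (fun m a b z => ((Lc ^ m : ℕ) : ℝ) ^ 8 * dressedEntry (colOf (KPerf (d := 3) Lc (sfStep Lc) (smStep 3 Lc) m))
              (hessKer (KPerf (d := 3) Lc (sfStep Lc) (smStep 3 Lc) 1)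
                (vertexOfK (KPerf (d := 3) Lc (sfStep Lc) (smStep 3 Lc) 1) Lc (SPerfOf (sfStep Lc) (smStep 3 Lc) S 1)) (WPerfOf (sfStep Lc) (smStep 3 Lc) Wt 1))
              (((Lc ^ m : ℕ) : ℤ) • z) a b) m) μ ν := by
  have hKinf : ∀ m : ℕ, 1 ≤ m → ∃ δ C : ℝ, 0 < δ ∧ 0 ≤ C ∧ Decays (KPerf (d := 3) Lc (sfStep Lc) (smStep 3 Lc) m) C δ := fun m hm => by
    obtain ⟨C, δ, hδ, hK⟩ := exists_decays_KPerf_holds hLc hm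
    exact ⟨δ, C, hδ, hK.nonneg (Sum.inl 0), hK⟩
  exact fPerfG_succ_of_ward_symm_defect (sfStep Lc) (smStep 3 Lc) (fun j m => KTot (d := 3) (Lc ^ (j + m)) (Lc ^ j))
    (fun j m => KTot (d := 3) (Lc ^ (j + m)) (Lc ^ j)) S Wt hLc hKinf hKinf hSinf hWinf hWf hTsymm μ ν

/-- **THE SAME, WITH THE JET CLASS DATA FROM FINITE-`j` ROWS, DEFECT DISPLAYED** [our object]: for every `m ≥ 1`, uniform `LocStencil` rows + all-scales
deviations (`θ m < 1`, `δs m > 0`) of the unit-rescaled (j, m)-stencils (X1m-S) and uniform `VertexFamily₂` rows at blocking `Lc^m` + deviations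
(`δw m > 0`) of the unit-rescaled (j, m)-tables (X1m-W) REPLACE the class data of the perfect jets (`PerfectJetLetters.locStencil_sPerf_of_rows`, asym1's
`vertexFamily₂_limTabOf`); `hWf`, `hTsymm` as above ⊢ the variable-defect step law.  `StepLawLeft.stepLaw_left_of_rows_ward_symm_explicitDefect` with
`hSDF` STRUCK. -/
theorem stepLaw_left_of_rows_ward_symm_defect (hLc : 2 ≤ Lc) {Cs cS δs θS Cw cW δw θW : ℕ → ℝ}
    (hS : ∀ m : ℕ, 1 ≤ m → ∀ j, LocStencil (unitS (sfStep Lc j) (smStep 3 Lc j) (S j m)) (Cs m) (δs m))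
    (hSall : ∀ m : ℕ, 1 ≤ m → ∀ k j,
      LocStencil (unitS (sfStep Lc (k + j)) (smStep 3 Lc (k + j)) (S (k + j) m) - unitS (sfStep Lc k) (smStep 3 Lc k) (S k m)) (cS m * θS m ^ k) (δs m))
    (hθS : ∀ m : ℕ, 1 ≤ m → θS m < 1) (hδs : ∀ m : ℕ, 1 ≤ m → 0 < δs m)
    (hW : ∀ m : ℕ, 1 ≤ m → ∀ j, VertexFamily₂ (unitW (sfStep Lc j) (smStep 3 Lc j) (Wt j m)) (Lc ^ m) (Cw m) (δw m))
    (hWall : ∀ m : ℕ, 1 ≤ m → ∀ k j,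
      VertexFamily₂ (unitW (sfStep Lc (k + j)) (smStep 3 Lc (k + j)) (Wt (k + j) m) - unitW (sfStep Lc k) (smStep 3 Lc k) (Wt k m)) (Lc ^ m)
        (cW m * θW m ^ k) (δw m))
    (hθW : ∀ m : ℕ, 1 ≤ m → θW m < 1) (hδw : ∀ m : ℕ, 1 ≤ m → 0 < δw m)
    (hWf : WardTransversal (flipK (hessKer (KPerf (d := 3) Lc (sfStep Lc) (smStep 3 Lc) 1)
      (vertexOfK (KPerf (d := 3) Lc (sfStep Lc) (smStep 3 Lc) 1) Lc (SPerfOf (sfStep Lc) (smStep 3 Lc) S 1)) (WPerfOf (sfStep Lc) (smStep 3 Lc) Wt 1))))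
    (hTsymm : ∀ a b t, hessKer (KPerf (d := 3) Lc (sfStep Lc) (smStep 3 Lc) 1)
        (vertexOfK (KPerf (d := 3) Lc (sfStep Lc) (smStep 3 Lc) 1) Lc (SPerfOf (sfStep Lc) (smStep 3 Lc) S 1)) (WPerfOf (sfStep Lc) (smStep 3 Lc) Wt 1) a b t =
      hessKer (KPerf (d := 3) Lc (sfStep Lc) (smStep 3 Lc) 1)
        (vertexOfK (KPerf (d := 3) Lc (sfStep Lc) (smStep 3 Lc) 1) Lc (SPerfOf (sfStep Lc) (smStep 3 Lc) S 1)) (WPerfOf (sfStep Lc) (smStep 3 Lc) Wt 1) b a (-t))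
    (μ ν : Fin 4) :
    ∀ m : ℕ, 1 ≤ m →
      fPerfG Lc (sfStep Lc) (smStep 3 Lc) (fun j m => KTot (d := 3) (Lc ^ (j + m)) (Lc ^ j)) (fun j m => KTot (d := 3) (Lc ^ (j + m)) (Lc ^ j))
          S Wt μ ν (m + 1) =
        fPerfG Lc (sfStep Lc) (smStep 3 Lc) (fun j m => KTot (d := 3) (Lc ^ (j + m)) (Lc ^ j)) (fun j m => KTot (d := 3) (Lc ^ (j + m)) (Lc ^ j))
            S Wt μ ν m +
          fPerfG Lc (sfStep Lc) (smStep 3 Lc) (fun j m => KTot (d := 3) (Lc ^ (j + m)) (Lc ^ j)) (fun j m => KTot (d := 3) (Lc ^ (j + m)) (Lc ^ j))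
            S Wt μ ν 1 +
          secondMoment (defect
            (fun m => hessKer (KPerf (d := 3) Lc (sfStep Lc) (smStep 3 Lc) m)
              (vertexOfK (KPerf (d := 3) Lc (sfStep Lc) (smStep 3 Lc) m) (Lc ^ m) (SPerfOf (sfStep Lc) (smStep 3 Lc) S m)) (WPerfOf (sfStep Lc) (smStep 3 Lc) Wt m))
            (fun m a b z => ((Lc ^ m : ℕ) : ℝ) ^ 8 * dressedEntry (colOf (KPerf (d := 3) Lc (sfStep Lc) (smStep 3 Lc) m))
              (hessKer (KPerf (d := 3) Lc (sfStep Lc) (smStep 3 Lc) 1)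
                (vertexOfK (KPerf (d := 3) Lc (sfStep Lc) (smStep 3 Lc) 1) Lc (SPerfOf (sfStep Lc) (smStep 3 Lc) S 1)) (WPerfOf (sfStep Lc) (smStep 3 Lc) Wt 1))
              (((Lc ^ m : ℕ) : ℤ) • z) a b) m) μ ν :=
  stepLaw_left_of_ward_symm_defect S Wt hLc
    (fun m hm => ⟨Cs m, δs m, hδs m hm, locStencil_sPerf_of_rows (sfStep Lc) (smStep 3 Lc) S m (hS m hm) (hSall m hm) (hθS m hm)⟩)
    (fun m hm => ⟨Cw m, δw m, hδw m hm,
      vertexFamily₂_limTabOf (W := fun j => unitW (sfStep Lc j) (smStep 3 Lc j) (Wt j m)) (hW m hm) (hWall m hm) (hθW m hm)⟩)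
    hWf hTsymm μ ν

end Left

end Summit.QuantumFields.BalabanUV.Beta.FP.StepLawLeftDefect

end
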